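import Literature.MathematicalPhysics.PowerSystems.NormalOperationStability
import HarnessLib

/-!
# Multistability on a ring: the `q`-twisted synchronous states of a homogeneous ring of machines
# are STABLE synchronous solutions of the damped swing model whenever `4|q| < N`
# (Wiley–Strogatz–Girvan 2006 twisted states; Manik–Timme–Witthaut 2017 §5.4 ring networks)

Topic `Literature/MathematicalPhysics/PowerSystems`, namespace
`Literature.MathematicalPhysics.PowerSystems.ClassicalModel`. Builds on
`NormalOperationStability.lean` (`LosslessSystem.stable_syncSolution_of_normalOperation`: on a
connected network a synchronous state with positive cosine on every line is a stable synchronous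
solution — Manik–Timme–Witthaut Cor. 1, census-free) and on the connectivity notion
`CouplingConnected` of `PhaseCohesiveEquilibriumUniqueness.lean`. Two small DEFINITIONS with
bodies (`ringSystem`, `twistedState`) and PROVED theorems; no named fact, no new axiom. The cyclic
neighbour is the rotation `finRotate (n+1)` of `Fin (n+1)` (no ring structure on `Fin` is used).

SOURCES (read on the page this session).

* D. Manik, M. Timme, D. Witthaut, *Cycle flows and multistability in oscillatory networks*,
  Chaos 27 (2017) 083123 [ManikTimmeWitthaut2017] (arXiv:1611.09825; chunks p0004, p0012–p0013):
  §3 **Cor. 1** (p0004 L68–77) «Consider a simply connected network. A fixed point θ* is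
  transversally asymptotically stable if cos(θ*ᵢ − θ*ⱼ) > 0 holds for all edges (i, j)»; §5.4
  *Simple cycles* (p0012 L25–33) «For networks containing a single cycle … These states correspond
  to the normal operation of a power grid and are guaranteed to be stable by corollary 1»; **Cor. 4**
  (p0013 L121–132, homogeneous rings `K_{i,i+1} = K`): bounds on the number 𝒩 of normal-operation
  fixed points, «In particular, ring networks R_N with N ≤ 4 do not have multiple stable fixed
  points. Ring networks R_N with N ≥ 7 nodes will have multiple stable fixed points (𝒩 ≥ 2) if
  P̄_max < 2K_min − 4πK_max/N».
* D. A. Wiley, S. H. Strogatz, M. Girvan, *The size of the sync basin*, Chaos 16 (2006) 015103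
  [WileyStrogatzGirvan2006] — the `q`-twisted states `θⱼ = 2πqj/N` of a ring of identical
  oscillators and their linear stability for `|q| < N/4` (paywalled here, acq-13584; read through
  the secondary source A. Mihara, M. Zaks, E. E. N. Macau, R. O. Medrano-T, *Basin sizes depend on
  stable eigenvalues in the Kuramoto model*, Phys. Rev. E 105 (2022) L052202 [MiharaEtAl2022],
  arXiv:2112.10040 §I (chunk p0005 L50–95): «In the states with q ≠ 0 all oscillators are
  synchronized in frequency but with a constant phase difference between two successive units:
  Δⱼ ≡ θⱼ − θⱼ₋₁ = 2πq/N … Such states are also known as "q-twisted" states», eigenvalues (4)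
  `γ_ℓ(q) = −4G Σ_{k=1}^R cos(k·2πq/N) sin²(kπℓ/N)` — for nearest neighbours (`R = 1`) all
  negative iff `cos(2πq/N) > 0`, i.e. `|q| < N/4`).

## What is proved (ring of `N = n + 1` machines; statements over `Fin (n + 1)`)

* `ringSystem n K M D` — the homogeneous UNLOADED ring: machines `0, …, n` on a cycle, coupling
  `K` between cyclic neighbours (`Cᵢⱼ = K` iff `j = ρ i` or `i = ρ j`, `ρ = finRotate (n+1)` the
  cyclic shift `i ↦ i + 1 (mod n+1)`), zero net power injections, inertias `M`, dampings `D`, no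
  infinite bus; `twistedState n q` — the `q`-twisted state `θⱼ = 2πq·j/(n+1)`, `q ∈ ℤ`.
* `sin_twisted_edge`, `cos_twisted_edge` — along every ring edge the twisted state turns by
  `2πq/(n+1)` modulo `2πq`: `sin(θᵢ − θ_{ρ i}) = −sin(2πq/(n+1))`, `cos(θᵢ − θ_{ρ i}) = cos(2πq/(n+1))`.
* `ringSystem_flow_twistedState` (`n ≥ 2`, i.e. at least three machines) — every twisted state
  solves the power-balance equations (2) of the unloaded ring (the flows on the two edges at each
  node cancel); `twistedState_isSyncState` (synchronous state, synchronous frequency `0`).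
* `twistedState_normalOperation` — if `4|q| < n + 1` then `cos(θᵢ − θⱼ) = cos(2πq/(n+1)) > 0` on
  every ring edge (normal operation).
* `ringSystem_couplingConnected` — the ring is connected (`K > 0`).
* ★ **`twistedState_stable`** — `n ≥ 2`, `K > 0`, `Mᵢ, Dᵢ > 0`, `4|q| < n + 1`: the `q`-twisted
  state is a STABLE synchronous state of the damped swing model on the ring: for every `ε > 0`
  there is `δ > 0` such that every motion from a state within `δ` of `(θ_q, 0)` stays within `ε` of
  `(θ_q, 0)` for all `t ≥ 0` and converges to the rotated rest point `(θ_q + a𝟙, 0)` of its own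
  momentum leaf (`stable_syncSolution_of_normalOperation`).
* `twistedState_not_rotation` — for `q ≠ q'` the states `θ_q`, `θ_{q'}` are not rotations of each
  other (`n ≥ 1`); hence ★★ **`ring_multistable`**: for every `q ≠ q'` with `4|q|, 4|q'| < n + 1`
  the ring carries two geometrically distinct stable synchronous states — e.g. `q ∈ {−1, 0, 1}` for
  `N = n + 1 ≥ 5`: COEXISTING STABLE SYNCHRONOUS STATES (multistability) of the damped swing
  model, certified for the motions, with no eigenvalue and no census.

DEVIATIONS FROM THE PRINTED SOURCES. WSG2006 / Mihara et al. treat the first-order (Kuramoto)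
ring and conclude linear stability from the eigenvalues `γ_ℓ(q)`; MTW2017 Lemma 1 / Cor. 1 state
that normal-operation fixed points are (transversally asymptotically) stable «for both Kuramoto
system and the power grid model». Here: the second-order damped swing model, nonlinear Lyapunov
stability with convergence to the leaf's rest point, by the energy route of
`NonMinimumEquilibriumInstability` §9–§11 (no spectrum); the converse («unstable for
`|q| > N/4`», all edges then have negative cosine) is NOT in this file. MTW2017 Cor. 4's sufficient
condition gives multistability of the unloaded homogeneous ring for `N ≥ 7`; the twisted states give
it already for `N ≥ 5` (consistent: Cor. 4 is a bound, not sharp).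

THREE COLUMNS (LADDER-GRIDFUSION honest framing). CERTIFIED for MODEL `M` = damped lossless
network-reduced swing model on a homogeneous unloaded ring (`P = 0`, uniform `K > 0`,
`Mᵢ, Dᵢ > 0`; MODEL-VALIDITY MV-1 class — an idealised ring, not a grid record); CLASS `C` = the
`δ`-ball around each twisted synchronous state. «Stable» / «multistable» refer to synchronous states
of MODEL `M`, never to a grid. NOT CLAIMED: basin sizes (the subject of WSG2006), loaded or
inhomogeneous rings (MTW2017 Thm 12 / Cor. 3 count them — not typed here), instability of the
states with `4|q| > N`.
-/

noncomputable section

open Real Set Filter Topology Metric Finset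

namespace Literature.MathematicalPhysics.PowerSystems

namespace ClassicalModel

/-- **The homogeneous unloaded ring `R_N`** (`N = n + 1` machines on a cycle): coupling `K`
between cyclic neighbours `i`, `ρ i` (`ρ = finRotate (n+1)`, so machine `n` is coupled back to
machine `0`), no other lines, zero net power injections, inertias `M`, dampings `D`, no infinite
bus. [cite: ManikTimmeWitthaut2017, §5.4 («We label the nodes as 1,2,…,N along the cycle … identify the node 1 with N+1») and Cor. 4 («homogeneous rings R_N, i.e. K_{i,i+1} = K»); MiharaEtAl2022, §I eq. (1) (ring of N identical oscillators, nearest neighbours R = 1)] -/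
def ringSystem (n : ℕ) (K : ℝ) (M D : Fin (n + 1) → ℝ) : LosslessSystem (n + 1) 0 where
  M := M
  D := D
  P := fun _ => 0
  C := fun i j => if j = finRotate (n + 1) i ∨ i = finRotate (n + 1) j then K else 0
  K := fun _ b => b.elim0
  β := fun b => b.elim0

/-- **The `q`-twisted state** of the ring of `n + 1` machines: `θⱼ = 2πq·j/(n+1)` («a constant
phase difference between two successive units: Δⱼ ≡ θⱼ − θⱼ₋₁ = 2πq/N … "q-twisted" states»;
`q` is the winding number of MTW2017). [cite: MiharaEtAl2022, §I eq. (3) and the following text; WileyStrogatzGirvan2006, (twisted states); ManikTimmeWitthaut2017, §3.2 Def. (winding number) and §5.4] -/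
def twistedState (n : ℕ) (q : ℤ) : Fin (n + 1) → ℝ := fun j => 2 * π * q * (j.val : ℝ) / (n + 1)

section Ring

variable {n : ℕ} (K : ℝ) (M D : Fin (n + 1) → ℝ) (q : ℤ)

/-- Unfolding of the ring coupling: `Cᵢⱼ = K` exactly on the ring edges `j = ρ i`, `i = ρ j`.
[cite: ManikTimmeWitthaut2017, §5.4 Cor. 4 («homogeneous rings R_N, i.e. K_{i,i+1} = K»)] -/
theorem ringSystem_C (i j : Fin (n + 1)) :
    (ringSystem n K M D).C i j
      = if j = finRotate (n + 1) i ∨ i = finRotate (n + 1) j then K else 0 := rfl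

/-- The ring coupling is symmetric. [cite: ManikTimmeWitthaut2017, §2 (symmetric coupling matrix K_{ij} = K_{ji})] -/
theorem ringSystem_C_symm : ∀ i j, (ringSystem n K M D).C i j = (ringSystem n K M D).C j i := by
  intro i j
  simp only [ringSystem_C]
  by_cases h : j = finRotate (n + 1) i ∨ i = finRotate (n + 1) j
  · rw [if_pos h, if_pos (Or.comm.1 h)]
  · rw [if_neg h, if_neg (fun h' => h (Or.comm.1 h'))]

/-- The ring couplings are non-negative when `K ≥ 0`. [folklore] [cite: ManikTimmeWitthaut2017, §5.4 Cor. 4] -/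
theorem ringSystem_C_nonneg (hK : 0 ≤ K) : ∀ i j, i ≠ j → 0 ≤ (ringSystem n K M D).C i j := by
  intro i j _
  simp only [ringSystem_C]
  split_ifs
  · exact hK
  · exact le_rfl

/-- **Along a ring edge the twisted state turns by `2πq/(n+1)` (modulo `2πq` at the seam)**: the
sine of the edge angle `θᵢ − θ_{ρ i}`. [folklore] [cite: MiharaEtAl2022, §I («Recalling that Δⱼ is taken mod 2π …»)] -/
theorem sin_twisted_edge (i : Fin (n + 1)) :
    Real.sin (twistedState n q i - twistedState n q (finRotate (n + 1) i))
      = -Real.sin (2 * π * q / (n + 1)) := by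
  have hN : ((n : ℝ) + 1) ≠ 0 := by positivity
  have hv := coe_finRotate i
  by_cases hl : i = Fin.last n
  · rw [if_pos hl] at hv
    have hi : (i.val : ℝ) = n := by rw [hl, Fin.val_last]
    have hr : ((finRotate (n + 1) i).val : ℝ) = 0 := by exact_mod_cast hv
    simp only [twistedState, hi, hr, mul_zero, zero_div, sub_zero]
    have e : 2 * π * q * (n : ℝ) / (n + 1) = (q : ℤ) * (2 * π) - 2 * π * q / (n + 1) := by
      field_simp
      ring
    rw [e, Real.sin_int_mul_two_pi_sub]
  · rw [if_neg hl] at hv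
    have hr : ((finRotate (n + 1) i).val : ℝ) = i.val + 1 := by exact_mod_cast hv
    simp only [twistedState, hr]
    have e : 2 * π * q * (i.val : ℝ) / (n + 1) - 2 * π * q * ((i.val : ℝ) + 1) / (n + 1)
        = -(2 * π * q / (n + 1)) := by
      field_simp
      ring
    rw [e, Real.sin_neg]

/-- … and its cosine: `cos(θᵢ − θ_{ρ i}) = cos(2πq/(n+1))`. [folklore] [cite: MiharaEtAl2022, §I] -/
theorem cos_twisted_edge (i : Fin (n + 1)) :
    Real.cos (twistedState n q i - twistedState n q (finRotate (n + 1) i))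
      = Real.cos (2 * π * q / (n + 1)) := by
  have hN : ((n : ℝ) + 1) ≠ 0 := by positivity
  have hv := coe_finRotate i
  by_cases hl : i = Fin.last n
  · rw [if_pos hl] at hv
    have hi : (i.val : ℝ) = n := by rw [hl, Fin.val_last]
    have hr : ((finRotate (n + 1) i).val : ℝ) = 0 := by exact_mod_cast hv
    simp only [twistedState, hi, hr, mul_zero, zero_div, sub_zero]
    have e : 2 * π * q * (n : ℝ) / (n + 1) = (q : ℤ) * (2 * π) - 2 * π * q / (n + 1) := by
      field_simp
      ring
    rw [e, Real.cos_int_mul_two_pi_sub]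
  · rw [if_neg hl] at hv
    have hr : ((finRotate (n + 1) i).val : ℝ) = i.val + 1 := by exact_mod_cast hv
    simp only [twistedState, hr]
    have e : 2 * π * q * (i.val : ℝ) / (n + 1) - 2 * π * q * ((i.val : ℝ) + 1) / (n + 1)
        = -(2 * π * q / (n + 1)) := by
      field_simp
      ring
    rw [e, Real.cos_neg]

/-- On a ring of at least three machines the two neighbours `ρ k` and `ρ⁻¹ k` of a node are
different (private plumbing). [folklore] -/
private theorem rotate_ne_rotate_symm (hn : 2 ≤ n) (k : Fin (n + 1)) :
    finRotate (n + 1) k ≠ (finRotate (n + 1)).symm k := by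
  intro h
  set j := (finRotate (n + 1)).symm k with hj
  have hk : finRotate (n + 1) j = k := by simp [hj]
  -- `ρ (ρ j) = j`: impossible on a cycle of length ≥ 3
  have h2 : finRotate (n + 1) (finRotate (n + 1) j) = j := by rw [hk]; exact h
  have hval : (finRotate (n + 1) (finRotate (n + 1) j)).val = j.val := by rw [h2]
  have hv1 : (finRotate (n + 1) j).val = if j = Fin.last n then 0 else j.val + 1 := coe_finRotate j
  have hv2 : (finRotate (n + 1) (finRotate (n + 1) j)).val
      = if finRotate (n + 1) j = Fin.last n then 0 else (finRotate (n + 1) j).val + 1 :=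
    coe_finRotate _
  have hjlt : j.val < n + 1 := j.isLt
  by_cases hl : j = Fin.last n
  · have hjn : j.val = n := by rw [hl, Fin.val_last]
    rw [if_pos hl] at hv1
    have hne : finRotate (n + 1) j ≠ Fin.last n := by
      intro h'
      have h'' := congrArg Fin.val h'
      rw [hv1, Fin.val_last] at h''
      omega
    rw [if_neg hne, hv1] at hv2
    omega
  · rw [if_neg hl] at hv1
    have hjn : j.val ≠ n := fun h' => hl (Fin.ext (by rw [h', Fin.val_last]))
    by_cases hl2 : finRotate (n + 1) j = Fin.last n
    · have h'' := congrArg Fin.val hl2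
      rw [hv1, Fin.val_last] at h''
      rw [if_pos hl2] at hv2
      omega
    · rw [if_neg hl2, hv1] at hv2
      omega

/-- **Every twisted state solves the power-balance equations of the unloaded ring** (at least
three machines): at node `k` the flows `K sin(θ_k − θ_{ρk}) = −K sin(2πq/(n+1))` and
`K sin(θ_k − θ_{ρ⁻¹k}) = +K sin(2πq/(n+1))` cancel. [cite: MiharaEtAl2022, §I (twisted states are equilibria of the ring); ManikTimmeWitthaut2017, §5.4] -/
theorem ringSystem_flow_twistedState (hn : 2 ≤ n) (k : Fin (n + 1)) :
    (ringSystem n K M D).flow (twistedState n q) k = 0 := by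
  have hab : finRotate (n + 1) k ≠ (finRotate (n + 1)).symm k := rotate_ne_rotate_symm hn k
  have hkb : finRotate (n + 1) ((finRotate (n + 1)).symm k) = k := by simp
  have hflow : (ringSystem n K M D).flow (twistedState n q) k
      = ∑ j, (if j = finRotate (n + 1) k ∨ k = finRotate (n + 1) j then K else 0)
          * Real.sin (twistedState n q k - twistedState n q j) := by
    simp [LosslessSystem.flow, ringSystem]
  -- the coupling row of `k` is supported on its two neighbours
  have hrow : ∀ j, (if j = finRotate (n + 1) k ∨ k = finRotate (n + 1) j then K else 0)
      = (if j = finRotate (n + 1) k then K else 0)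
        + (if j = (finRotate (n + 1)).symm k then K else 0) := by
    intro j
    have hiff : (k = finRotate (n + 1) j) ↔ (j = (finRotate (n + 1)).symm k) := by
      rw [Equiv.eq_symm_apply]
      exact eq_comm
    simp only [hiff]
    by_cases h1 : j = finRotate (n + 1) k
    · have h2 : j ≠ (finRotate (n + 1)).symm k := fun h => hab (h1.symm.trans h)
      rw [if_pos (Or.inl h1), if_pos h1, if_neg h2, add_zero]
    · by_cases h2 : j = (finRotate (n + 1)).symm k
      · rw [if_pos (Or.inr h2), if_neg h1, if_pos h2, zero_add]
      · rw [if_neg (not_or.2 ⟨h1, h2⟩), if_neg h1, if_neg h2, add_zero]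
  rw [hflow]
  simp only [hrow, add_mul, Finset.sum_add_distrib, ite_mul, zero_mul, Finset.sum_ite_eq',
    Finset.mem_univ, if_true]
  -- the two edge sines cancel
  have h1 : Real.sin (twistedState n q k - twistedState n q (finRotate (n + 1) k))
      = -Real.sin (2 * π * q / (n + 1)) := sin_twisted_edge q k
  have h2 : Real.sin (twistedState n q k - twistedState n q ((finRotate (n + 1)).symm k))
      = Real.sin (2 * π * q / (n + 1)) := by
    have h := sin_twisted_edge q ((finRotate (n + 1)).symm k)
    rw [hkb] at h
    rw [← neg_sub (twistedState n q ((finRotate (n + 1)).symm k)) (twistedState n q k),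
      Real.sin_neg, h, neg_neg]
  rw [h1, h2]
  ring

/-- The twisted states are SYNCHRONOUS STATES of the unloaded ring (synchronous frequency
`ΣPₖ/ΣDₖ = 0`): `Pₖ − Dₖ·0 = flowₖ(θ_q)`. [cite: ManikTimmeWitthaut2017, §5.4; MiharaEtAl2022, §I] -/
theorem twistedState_isSyncState (hn : 2 ≤ n) : ∀ k, (ringSystem n K M D).P k
      - (ringSystem n K M D).D k * ((∑ j, (ringSystem n K M D).P j) / ∑ j, (ringSystem n K M D).D j)
    = (ringSystem n K M D).flow (twistedState n q) k := by
  intro k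
  rw [ringSystem_flow_twistedState K M D q hn]
  simp [ringSystem]

/-- **Normal operation**: if `4|q| < n + 1` then every ring edge of the `q`-twisted state has
positive cosine, `cos(θᵢ − θⱼ) = cos(2πq/(n+1)) > 0`. [cite: ManikTimmeWitthaut2017, §3 Cor. 1 («normal operation») and §5.4; MiharaEtAl2022, §I eq. (4) (R = 1: stable iff cos(2πq/N) > 0)] -/
theorem twistedState_normalOperation (hq : 4 * |q| < (n : ℤ) + 1) :
    ∀ i j, i ≠ j → 0 < (ringSystem n K M D).C i j →
      0 < Real.cos (twistedState n q i - twistedState n q j) := by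
  have hN : (0 : ℝ) < (n : ℝ) + 1 := by positivity
  have hcos : 0 < Real.cos (2 * π * q / (n + 1)) := by
    have hq' : 4 * |(q : ℝ)| < (n : ℝ) + 1 := by exact_mod_cast hq
    have hπ := Real.pi_pos
    have hb : |2 * π * q / (n + 1)| < π / 2 := by
      rw [abs_div, abs_of_pos hN, div_lt_iff₀ hN, abs_mul,
        abs_of_pos (by positivity : (0:ℝ) < 2 * π)]
      nlinarith
    exact Real.cos_pos_of_mem_Ioo ⟨by linarith [neg_abs_le (2 * π * q / (n + 1))],
      by linarith [le_abs_self (2 * π * q / (n + 1))]⟩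
  intro i j hij hC
  simp only [ringSystem_C] at hC
  have hedge : j = finRotate (n + 1) i ∨ i = finRotate (n + 1) j := by
    by_contra h
    rw [if_neg h] at hC
    exact lt_irrefl _ hC
  rcases hedge with h | h
  · rw [h, cos_twisted_edge]
    exact hcos
  · rw [h, ← Real.cos_neg, neg_sub, cos_twisted_edge]
    exact hcos

/-- **The ring is connected** (`K > 0`): every cut of the machine set is crossed by a ring edge —
walk along `ρ` from inside the cut; since `ρ` visits every machine, the walk must leave the cut.
[cite: ManikTimmeWitthaut2017, §3 Cor. 1 (hypothesis «simply connected network»)] -/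
theorem ringSystem_couplingConnected (hK : 0 < K) : CouplingConnected (ringSystem n K M D).C := by
  intro S hS hSc
  by_contra hnot
  push Not at hnot
  have hstep : ∀ i ∈ S, finRotate (n + 1) i ∈ S := by
    intro i hi
    by_contra hout
    have h := hnot i hi (finRotate (n + 1) i) (Finset.mem_compl.2 hout)
    simp only [ringSystem_C, true_or, if_true] at h
    exact absurd hK (not_lt.2 h)
  obtain ⟨i₀, hi₀⟩ := hS
  -- iterate the rotation: every machine is reached (`finCycle (j − i₀) i₀ = j`)
  have hall : ∀ m : ℕ, (finRotate (n + 1))^[m] i₀ ∈ S := by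
    intro m
    induction m with
    | zero => simpa using hi₀
    | succ m ih =>
      rw [Function.iterate_succ_apply']
      exact hstep _ ih
  obtain ⟨j, hj⟩ := hSc
  have hjS : j ∈ S := by
    have h := hall (j - i₀).val
    have e : (finRotate (n + 1))^[(j - i₀).val] i₀ = j := by
      rw [← finCycle_eq_finRotate_iterate, finCycle_apply, add_sub_cancel]
    rw [e] at h
    exact h
  exact absurd hjS (Finset.mem_compl.1 hj)

/-- ★ **THE `q`-TWISTED STATE IS A STABLE SYNCHRONOUS STATE OF THE DAMPED SWING MODEL ON THE RING**
(`n + 1 ≥ 3` machines, `K > 0`, `Mᵢ, Dᵢ > 0`, `4|q| < n + 1`): for every `ε > 0` there is `δ > 0`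
such that from every state `x₁` with `dist(x₁, (θ_q, 0)) < δ` a forward-global motion exists and
EVERY one stays within `ε` of `(θ_q, 0)` for all `t ≥ 0` and converges to the rotated rest point
`(θ_q + a𝟙, 0)`, `a = Σᵢ(Mᵢωᵢ + Dᵢ(θᵢ − θ_qᵢ))/ΣDᵢ` the offset of its own momentum leaf —
«twisted states … stable [for |q| < N/4]» / «normal operation … guaranteed to be stable», at the
level of the motions of the second-order model.
[cite: WileyStrogatzGirvan2006, (q-twisted states stable for |q| < N/4); MiharaEtAl2022, §I eq. (4); ManikTimmeWitthaut2017, §3 Cor. 1 and §5.4] -/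
theorem twistedState_stable (hn : 2 ≤ n) (hK : 0 < K) (hM : ∀ i, 0 < M i) (hD : ∀ i, 0 < D i)
    (hq : 4 * |q| < (n : ℤ) + 1) {ε : ℝ} (hε : 0 < ε) :
    ∃ δ > 0, ∀ x₁ : (Fin (n + 1) → ℝ) × (Fin (n + 1) → ℝ),
      dist x₁ (twistedState n q, 0) < δ →
      (∃ X : ℝ → (Fin (n + 1) → ℝ) × (Fin (n + 1) → ℝ), X 0 = x₁ ∧
          ∀ T : ℝ, ∀ t ∈ Icc 0 T,
            HasDerivWithinAt X ((ringSystem n K M D).field (X t)) (Icc 0 T) t) ∧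
        ∀ X : ℝ → (Fin (n + 1) → ℝ) × (Fin (n + 1) → ℝ), X 0 = x₁ →
          (∀ T : ℝ, ∀ t ∈ Icc 0 T,
            HasDerivWithinAt X ((ringSystem n K M D).field (X t)) (Icc 0 T) t) →
          (∀ t, 0 ≤ t → dist (X t) (twistedState n q, 0) < ε) ∧
          Tendsto X atTop (𝓝 ((fun j => twistedState n q j +
            (∑ i, (M i * x₁.2 i + D i * (x₁.1 i - twistedState n q i))) / ∑ i, D i), 0)) := by
  have h := (ringSystem n K M D).stable_syncSolution_of_normalOperation (ringSystem_C_symm K M D)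
    (ringSystem_C_nonneg K M D hK.le) (ringSystem_couplingConnected K M D hK) hM hD
    (twistedState_isSyncState K M D q hn) (twistedState_normalOperation K M D q hq) hε
  have hP : (∑ j, (ringSystem n K M D).P j) / (∑ j, (ringSystem n K M D).D j) = 0 := by
    simp [ringSystem]
  simp only [hP, zero_mul, sub_zero, Prod.mk.eta] at h
  obtain ⟨δ, hδ, hst⟩ := h
  refine ⟨δ, hδ, fun x₁ hx₁ => ?_⟩
  have hx₁' : dist x₁ (twistedState n q, fun _ : Fin (n + 1) => (0 : ℝ)) < δ := hx₁
  obtain ⟨hex, hall⟩ := hst x₁ hx₁'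
  refine ⟨hex, fun X hX0 hX => ?_⟩
  obtain ⟨hstay, htend⟩ := hall X hX0 hX
  refine ⟨fun t ht => hstay t ht, ?_⟩
  simpa [ringSystem] using htend

/-- **Different winding numbers give geometrically different states**: for `q ≠ q'` (at least two
machines) `θ_q` is not a rotation `θ_{q'} + c𝟙` of `θ_{q'}`.
[cite: ManikTimmeWitthaut2017, §5.4 («the distinct fixed points correspond to the … values of the winding number»); MiharaEtAl2022, §I] -/
theorem twistedState_not_rotation (hn : 1 ≤ n) {q q' : ℤ} (hqq : q ≠ q') :
    ¬ ∃ c : ℝ, ∀ j, twistedState n q j = twistedState n q' j + c := by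
  rintro ⟨c, hc⟩
  have h0 := hc ⟨0, by omega⟩
  have h1 := hc ⟨1, by omega⟩
  simp only [twistedState, Nat.cast_zero, mul_zero, zero_div, zero_add] at h0
  simp only [twistedState, Nat.cast_one, mul_one] at h1
  rw [← h0, add_zero] at h1
  have hN : (0 : ℝ) < (n : ℝ) + 1 := by positivity
  have hπ := Real.pi_pos
  have h2 : (q : ℝ) = q' := by
    have h3 : 2 * π * (q : ℝ) = 2 * π * q' := by
      have := (div_left_inj' hN.ne').1 h1
      exact this
    have h4 : (2 * π) ≠ 0 := by positivity
    exact mul_left_cancel₀ h4 h3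
  exact hqq (by exact_mod_cast h2)

/-- ★★ **MULTISTABILITY OF THE RING: coexisting, geometrically distinct STABLE synchronous states.**
For every two winding numbers `q ≠ q'` with `4|q| < n + 1`, `4|q'| < n + 1` (ring of
`n + 1 ≥ 3` machines, `K > 0`, `Mᵢ, Dᵢ > 0`) the twisted states `θ_q`, `θ_{q'}` are BOTH stable
synchronous states of the damped swing model (conclusion of `twistedState_stable`) and are NOT
rotations of each other — e.g. `q ∈ {−1, 0, 1}` for `n + 1 ≥ 5`: at least three coexisting stable
synchronous states. («Ring networks … will have multiple stable fixed points»; «more twisted states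
(with q ≠ 0) become stable».)
[cite: ManikTimmeWitthaut2017, §5.4 Cor. 4; WileyStrogatzGirvan2006, (twisted states stable for |q| < N/4); MiharaEtAl2022, §I] -/
theorem ring_multistable (hn : 2 ≤ n) (hK : 0 < K) (hM : ∀ i, 0 < M i) (hD : ∀ i, 0 < D i)
    {q q' : ℤ} (hq : 4 * |q| < (n : ℤ) + 1) (hq' : 4 * |q'| < (n : ℤ) + 1) (hqq : q ≠ q') :
    (¬ ∃ c : ℝ, ∀ j, twistedState n q j = twistedState n q' j + c) ∧
      ∀ θe ∈ ({twistedState n q, twistedState n q'} : Set (Fin (n + 1) → ℝ)),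
        ∀ ε > 0, ∃ δ > 0, ∀ x₁ : (Fin (n + 1) → ℝ) × (Fin (n + 1) → ℝ), dist x₁ (θe, 0) < δ →
          (∃ X : ℝ → (Fin (n + 1) → ℝ) × (Fin (n + 1) → ℝ), X 0 = x₁ ∧
              ∀ T : ℝ, ∀ t ∈ Icc 0 T,
                HasDerivWithinAt X ((ringSystem n K M D).field (X t)) (Icc 0 T) t) ∧
            ∀ X : ℝ → (Fin (n + 1) → ℝ) × (Fin (n + 1) → ℝ), X 0 = x₁ →
              (∀ T : ℝ, ∀ t ∈ Icc 0 T,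
                HasDerivWithinAt X ((ringSystem n K M D).field (X t)) (Icc 0 T) t) →
              (∀ t, 0 ≤ t → dist (X t) (θe, 0) < ε) ∧
              Tendsto X atTop (𝓝 ((fun j => θe j +
                (∑ i, (M i * x₁.2 i + D i * (x₁.1 i - θe i))) / ∑ i, D i), 0)) := by
  refine ⟨twistedState_not_rotation (by omega) hqq, fun θe hθe ε hε => ?_⟩
  rcases hθe with h | h
  · subst h
    exact twistedState_stable K M D q hn hK hM hD hq hε
  · have h' : θe = twistedState n q' := h
    subst h'
    exact twistedState_stable K M D q' hn hK hM hD hq' hε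

end Ring

end ClassicalModel

end Literature.MathematicalPhysics.PowerSystems
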